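/-
Copyright (c) 2026 the pub-hodgecm-mathlib formalisation cell (harness21).  Prover seat hodgecm-mathlib-F0P3a-p01 (g37), FLOOR 0, SUPPORTS-ONLY on h413; β-BOARD v1
(assembler's gap cell A′, tower 3): the glued strata `![2ρ+s, 2ρ+s, 2ρ]` OFF the glue foot `n₃ ≠ n₂ + s` and ABOVE `min(n₁, n₂)` are EMPTY.  2026-09-04.
-/
import Summits.HodgeConjecture.HodgeConjecture.Theorems.F0P3cDyRamLabelledOddPureStrataG3Shell   -- ★ p861341 (LH7-p06 (g0)): brings ★ `stratum_G3_eq`, ★ `mapGL_latt_G3_eq_iff` (DiagonalGluedStratumG3), DEFS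
import Summits.HodgeConjecture.HodgeConjecture.Theorems.F0P3cDyRamDiagonalGluedStability          -- ★: `v_le_and_v_le_of_v_add_le_of_ne`
import Summits.HodgeConjecture.HodgeConjecture.Theorems.F0P3cDyRamLabelledOddCountDefs           -- ★ p860257: `labelledOddCount`
import Summits.HodgeConjecture.HodgeConjecture.Theorems.F0P3cDyRamStableCountTypeZero            -- ★: `v_diag_eq_one`
import HarnessLib

/-!
# Crux `H413`, line LH4 «(D-RAM) FOUR-FRAME» — (β-BAL) Stage B, the `hRest` coverage cell A′ FOR TOWER 3: OFF THE GLUE FOOT (`n₃ ≠ n₂ + s`), a glued stratum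
# `![2ρ+s, 2ρ+s, 2ρ]` with `min(n₁, n₂) < 2ρ` has NO member, so its clean-shell labelled-odd table is `0`

Cell `hodgecm-mathlib` (D-0151), FLOOR 0, crux item H413 = `stmt-HodgeConjecture-24833`, route `HCCMUnconditional`; squad F0∕P3c∕LH4.  THEOREMS ONLY (no `def`, no instance, no
notation, no `sorry`, default heartbeats); ★-only imports; lane `--supports stmt-HodgeConjecture-24833 --as helper` (count-neutral); pays NO row, states NO law.

THE MATHEMATICS.  ★ `stratum_G3_eq` presents every member of the tower-3 stratum `(2ρ+s, 2ρ+s, 2ρ)` (`ρ, s ≥ 1`) as a `T`-STABLE normal form `latt(1 0 0; x ϖ^{ρ+s} 0; y z ϖ^{2ρ})`,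
`|x| = |y| = 1`, `|z| = |ϖ^ρ|`; ★ `mapGL_latt_G3_eq_iff` at `T = diag(α, β, 1)` reads stability as `|β − α| ≤ |ϖ|^{ρ+s}`, `|1 − β| ≤ |ϖ|^ρ` and the corner condition
`|(1−α)·y·ϖ^{ρ+s} + (α−β)·x·z| ≤ |ϖ|^{3ρ+s}`, whose two terms have valuations `n₂ + ρ + s` and `n₃ + ρ`; OFF the foot `n₃ ≠ n₂ + s` they cannot cancel (★
`v_le_and_v_le_of_v_add_le_of_ne`), giving `2ρ ≤ n₂` and `2ρ + s ≤ n₃`, and the isosceles bound `min(n₂, n₃) ≤ n₁` adds `2ρ ≤ n₁`.  Hence `min(n₁, n₂) < 2ρ` leaves the stratum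
EMPTY — cell (5) of the tower-3 rest partition (twin of ★ p861495 ∕ its tower-2 transport).
HONEST LABEL.  Count-neutral helper (an EMPTY cell, value `0`); R6∕R7∕R8, `hRest`, (T3), `hbox`, (β-BAL), (β), T₊ remain OPEN; `HC_CM` is proved only modulo the 7 printed
citations (2 remaining named inputs: hLiu418 = `stmt-HodgeConjecture-24832`, h413 = `stmt-HodgeConjecture-24833`) until rung 0 closes.

## References
* [Kottwitz1986BaseChangeUnits] R. E. Kottwitz, *Base change for unit elements of Hecke algebras*, Compositio Math. 60 (1986), §1 pp. 240–241 (lattice counts by strata; stability).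
* [Serre1980Trees] J.-P. Serre, *Trees*, Springer (1980), Ch. II §1.1 (lattices `g·𝒪^N`, Hermite normal forms).
* [Rogawski1990] J. D. Rogawski, *Automorphic Representations of Unitary Groups in Three Variables*, Ann. of Math. Stud. 123 (1990), §4.9 Prop. 4.9.1 (a)(b) p. 55.
-/

set_option autoImplicit false

noncomputable section

namespace Summit.HodgeConjecture.HodgeConjecture.Cruxes.H413.F0P3cDyRamLabelledOddGluedOffFootHighG3

open Literature.NumberTheory.Automorphic Literature.NumberTheory.Automorphic.HermitianLattice
open Literature.NumberTheory.Automorphic.UnitaryLatticeTree Literature.NumberTheory.Automorphic.UnitaryThreeFourFrame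
open Literature.NumberTheory.LocalFields Literature.NumberTheory.LocalFields.WildQuadraticDatum
open Summit.HodgeConjecture.HodgeConjecture.Cruxes.H413.F0P3cDyRamFourFramePieces
open Summit.HodgeConjecture.HodgeConjecture.Cruxes.H413.F0P3cDyRamFourFrameCensusDefs
open Summit.HodgeConjecture.HodgeConjecture.Cruxes.H413.F0P3cDyRamDiagonalTorusDefs
open Summit.HodgeConjecture.HodgeConjecture.Cruxes.H413.F0P3cDyRamDiagonalStrataDefs
open Summit.HodgeConjecture.HodgeConjecture.Cruxes.H413.F0P3cDyRamLabelledOddCountDefs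
open Summit.HodgeConjecture.HodgeConjecture.Cruxes.H413.F0P3cDyRamDiagonalGluedStratumG3 (stratum_G3_eq mapGL_latt_G3_eq_iff)
open Summit.HodgeConjecture.HodgeConjecture.Cruxes.H413.F0P3cDyRamDiagonalGluedStability (v_le_and_v_le_of_v_add_le_of_ne)
open Summit.HodgeConjecture.HodgeConjecture.Cruxes.H413.F0P3cDyRamStableCountTypeZero (v_diag_eq_one)
open scoped Valued WithZero Matrix MatrixGroups

variable {K : Type} [Field K] [Valued K ℤᵐ⁰] {σ : K →+* K} {ϖ : K} {d t : ℕ} {α β : K} {N₀ n₁ n₂ n₃ : ℕ}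

/-! ## §1  Off the foot, the depths of a tower-3 glued member -/

/-- **OFF THE GLUE FOOT `n₃ ≠ n₂ + s`, EVERY MEMBER OF THE STRATUM `(2ρ+s, 2ρ+s, 2ρ)` HAS `2ρ + s ≤ n₃`, `2ρ ≤ n₂` AND `2ρ ≤ n₁`** (★ `mapGL_latt_G3_eq_iff`'s corner condition
with non-cancelling terms, plus the isosceles bound).  No cell, read or token hypothesis. [cite: Kottwitz1986BaseChangeUnits, §1 pp. 240–241] [cite: Serre1980Trees, Ch. II §1.1] -/
theorem depths_of_mem_stratum_G3_offFoot (hD : IsRamifiedQuadraticDatum σ ϖ d t) (hE : IsElementDatum σ ϖ N₀ α β n₁ n₂ n₃)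
    (T : GL (Fin 3) K) (hT : (T : Matrix (Fin 3) (Fin 3) K) = Matrix.diagonal ![α, β, 1]) {ρ s : ℕ} (hρ : 1 ≤ ρ) (hs : 1 ≤ s) (hfoot : n₃ ≠ n₂ + s)
    {M : Submodule 𝒪[K] (Fin 3 → K)} (hM : M ∈ stratum σ ϖ T ![2 * ρ + s, 2 * ρ + s, 2 * ρ]) :
    2 * ρ + s ≤ n₃ ∧ 2 * ρ ≤ n₂ ∧ 2 * ρ ≤ n₁ := by
  obtain ⟨-, hvσ, hϖ, hfix, -, -, -⟩ := hD
  have hϖ0 : ϖ ≠ 0 := fun h0 => by rw [h0, map_zero] at hϖ; exact WithZero.coe_ne_zero hϖ.symm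
  have hvϖ : 0 < Valued.v ϖ := (Valuation.pos_iff _).2 hϖ0
  have hϖlt : Valued.v ϖ < 1 := by rw [hϖ, ← WithZero.exp_zero, WithZero.exp_lt_exp]; norm_num
  have hα : Valued.v (α - 1) = Valued.v ϖ ^ n₂ := hE.2.2.2.2.2.2.1
  have hβ : Valued.v (β - 1) = Valued.v ϖ ^ n₁ := hE.2.2.2.2.2.1
  have hγ : Valued.v (α - β) = Valued.v ϖ ^ n₃ := hE.2.2.2.2.2.2.2.1
  have hγ' : Valued.v (β - 1 - (α - 1)) = Valued.v ϖ ^ n₃ := by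
    rw [show β - 1 - (α - 1) = -(α - β) by ring, Valuation.map_neg, hγ]
  have hpw : ∀ a b : ℕ, Valued.v ϖ ^ a ≤ Valued.v ϖ ^ b ↔ b ≤ a := fun a b => by
    rw [v_varpi_pow hϖ, v_varpi_pow hϖ, WithZero.exp_le_exp]; omega
  have hn₁min : min n₂ n₃ ≤ n₁ := by
    -- `β − 1 = (α − 1) − (α − β)`: the ultrametric inequality
    have h := Valuation.map_sub Valued.v (α - 1) (α - β)
    rw [show α - 1 - (α - β) = β - 1 by ring, hβ, hα, hγ, le_max_iff, hpw, hpw] at h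
    omega
  have hsv := v_diag_eq_one hvσ hE
  have hu : ∀ i : Fin 3, Valued.v ((![α, β, 1] : Fin 3 → K) i) = 1 := by
    intro i; fin_cases i
    · simpa using hsv 0
    · simpa using hsv 1
    · simp
  rw [stratum_G3_eq hvσ hfix hϖ T hρ hs] at hM
  obtain ⟨x, y, z, hx, hy, hz, rfl, hTM, -⟩ := hM
  obtain ⟨-, -, hc⟩ := (mapGL_latt_G3_eq_iff hϖ0 ![α, β, 1] hu T hT hx y hz).1 hTM
  simp only [Matrix.cons_val_zero, Matrix.cons_val_one, Matrix.cons_val_two, Matrix.tail_cons, Matrix.head_cons] at hc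
  -- valuations of the two corner terms
  have hva : Valued.v ((1 - α) * y * ϖ ^ (ρ + s)) = Valued.v ϖ ^ (n₂ + (ρ + s)) := by
    rw [map_mul, map_mul, show (1 : K) - α = -(α - 1) by ring, Valuation.map_neg, hα, hy, mul_one, map_pow, ← pow_add]
  have hvb : Valued.v ((α - β) * x * z) = Valued.v ϖ ^ (n₃ + ρ) := by
    rw [map_mul, map_mul, hγ, hx, mul_one, hz, map_pow, ← pow_add]
  have hne : Valued.v ((1 - α) * y * ϖ ^ (ρ + s)) ≠ Valued.v ((α - β) * x * z) := by
    rw [hva, hvb]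
    exact fun h => hfoot (by have := pow_right_injective₀ hvϖ hϖlt.ne h; omega)
  obtain ⟨ha, hb⟩ := v_le_and_v_le_of_v_add_le_of_ne hne hc
  rw [hva, map_pow, hpw] at ha
  rw [hvb, map_pow, hpw] at hb
  refine ⟨by omega, by omega, ?_⟩
  rcases le_total n₂ n₃ with h | h
  · rw [min_eq_left h] at hn₁min; omega
  · rw [min_eq_right h] at hn₁min; omega

/-- **A′ (tower 3) · OFF THE GLUE FOOT AND ABOVE `min(n₁, n₂)` THE STRATUM `(2ρ+s, 2ρ+s, 2ρ)` IS EMPTY.** [cite: Kottwitz1986BaseChangeUnits, §1 pp. 240–241] [cite: Serre1980Trees, Ch. II §1.1] -/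
theorem stratum_G3_eq_empty_of_offFoot_of_lt (hD : IsRamifiedQuadraticDatum σ ϖ d t) (hE : IsElementDatum σ ϖ N₀ α β n₁ n₂ n₃)
    (T : GL (Fin 3) K) (hT : (T : Matrix (Fin 3) (Fin 3) K) = Matrix.diagonal ![α, β, 1]) {ρ s : ℕ} (hρ : 1 ≤ ρ) (hs : 1 ≤ s) (hfoot : n₃ ≠ n₂ + s)
    (hlt : min n₁ n₂ < 2 * ρ) : stratum σ ϖ T ![2 * ρ + s, 2 * ρ + s, 2 * ρ] = ∅ := by
  refine Set.eq_empty_iff_forall_notMem.2 fun M hM => ?_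
  obtain ⟨-, h2, h1⟩ := depths_of_mem_stratum_G3_offFoot hD hE T hT hρ hs hfoot hM
  exact absurd (le_min h1 h2) (not_le.2 hlt)

/-! ## §2  Hence every cut table over it vanishes -/

/-- **ANY CUT, ANY WEIGHT: `Σᶠ_{M ∈ stratum (2ρ+s, 2ρ+s, 2ρ), Q M} f M = 0` OFF THE FOOT ABOVE `min(n₁, n₂)`.** [cite: Kottwitz1986BaseChangeUnits, §1 pp. 240–241] -/
theorem finsum_stratum_G3_sep_eq_zero_of_offFoot_of_lt (hD : IsRamifiedQuadraticDatum σ ϖ d t) (hE : IsElementDatum σ ϖ N₀ α β n₁ n₂ n₃)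
    (T : GL (Fin 3) K) (hT : (T : Matrix (Fin 3) (Fin 3) K) = Matrix.diagonal ![α, β, 1]) {ρ s : ℕ} (hρ : 1 ≤ ρ) (hs : 1 ≤ s) (hfoot : n₃ ≠ n₂ + s)
    (hlt : min n₁ n₂ < 2 * ρ) (Q : Submodule 𝒪[K] (Fin 3 → K) → Prop) (f : Submodule 𝒪[K] (Fin 3 → K) → ℚ) :
    ∑ᶠ M ∈ {M : Submodule 𝒪[K] (Fin 3 → K) | M ∈ stratum σ ϖ T ![2 * ρ + s, 2 * ρ + s, 2 * ρ] ∧ Q M}, f M = 0 := by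
  have hempty : {M : Submodule 𝒪[K] (Fin 3 → K) | M ∈ stratum σ ϖ T ![2 * ρ + s, 2 * ρ + s, 2 * ρ] ∧ Q M} = ∅ := by
    refine Set.eq_empty_iff_forall_notMem.2 fun M hM => ?_
    have h := hM.1
    rw [stratum_G3_eq_empty_of_offFoot_of_lt hD hE T hT hρ hs hfoot hlt] at h
    exact h
  rw [hempty, finsum_mem_empty]

/-! ## §3  β-BOARD common shape: cell A′ of the tower-3 `hRest` partition -/

/-- **A′ (tower 3) · β-BOARD COMMON SHAPE — OFF THE FOOT (`n₃ ≠ n₂ + s`), ABOVE `min(n₁, n₂)` (`min n₁ n₂ < 2ρ`): the clean-shell labelled-odd table of the stratum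
`(2ρ+s, 2ρ+s, 2ρ)` is `0`** in every slot, for any label and any square level. [cite: Kottwitz1986BaseChangeUnits, §1 pp. 240–241] [cite: Rogawski1990, §4.9 Prop. 4.9.1 (a)(b) p. 55] -/
theorem finsum_stratum_G3_shell_labelledOdd_div_relIndex_eq_zero_of_offFoot_of_lt (hD : IsRamifiedQuadraticDatum σ ϖ d t)
    (hE : IsElementDatum σ ϖ N₀ α β n₁ n₂ n₃) (T : GL (Fin 3) K) (hT : (T : Matrix (Fin 3) (Fin 3) K) = Matrix.diagonal ![α, β, 1])
    (ρ s : ℕ) (hρ : 1 ≤ ρ) (hs : 1 ≤ s) (hfoot : n₃ ≠ n₂ + s) (hlt : min n₁ n₂ < 2 * ρ) (ℓ₂ : ℕ) (i : Fin 3)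
    (Λ : Submodule 𝒪[K] (Fin 3 → K) → (Fin 3 → K) → Prop) :
    ∑ᶠ M ∈ {M : Submodule 𝒪[K] (Fin 3 → K) | M ∈ stratum σ ϖ T ![2 * ρ + s, 2 * ρ + s, 2 * ρ] ∧
        (LatticeInLevel ϖ (d % 2) (Matrix.diagonal ![α - 1, β - 1, 0]) M ∧ ¬ LatticeInLevel ϖ (d % 2 + 1) (Matrix.diagonal ![α - 1, β - 1, 0]) M ∧
          LatticeInLevel ϖ ℓ₂ (Matrix.diagonal ![(α - 1) * (α - 1), (β - 1) * (β - 1), 0]) M)},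
      (labelledOddCount σ ϖ 0 i Λ M : ℚ) / ((((unitStabilizer M).map (unitNormMap σ 3)).relIndex (fixedUnitTorus σ 3) : ℕ) : ℚ) = 0 :=
  finsum_stratum_G3_sep_eq_zero_of_offFoot_of_lt hD hE T hT hρ hs hfoot hlt _ _

end Summit.HodgeConjecture.HodgeConjecture.Cruxes.H413.F0P3cDyRamLabelledOddGluedOffFootHighG3

end
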